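import Mathlib
import HarnessLib
import Summits.AtomisticToContinuum.FouriersLaw.Theorems.JunctionLocalityNonBallisticLightConeMomentumTail

/-!
# Short-time dipole floor, helper 9: stationarity of the flipped flow and moments of the light-cone weights

Helper (`--supports stmt-AtomisticToContinuum-11749`) for stub `stub_shortTimeDipoleFloor` (S) of line
`kick-dipole-no-collapse`, crux `JunctionLocality.ConductanceLowerBound`.

Expectations under the stationary law `π = μ_T ⊗ W` (Gibbs ⊗ Wiener) of functionals of the strong solution
`Φ_r(x, Bω) = solMap N T T r x (pairPath ω)` of the pinned chain with both baths at `T`, in `ℝ≥0∞`: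

* `lintegral_prod_solMap_flip_gibbs` — stationarity from the FLIPPED start: `∫⁻ g(Φ_r(x^{i₀}, Bω)) dπ = ∫⁻ g dμ_T`
  (`x ↦ x^{i₀}` preserves `μ_T`, then `NonBallistic.pinnedChain_lintegral_prod_solMap_gibbs`);
* `lintegral_timeIntegral_momentum_sq_pow_le` — `∫⁻ (∫₀ᵗ p_m(Φ_r)² dr)^{n} dπ ≤ t^{n} ∫ p_m^{2n} dμ_T` (Jensen in time,
  Tonelli, stationarity), from either start;
* consequences for the light-cone site weights `θ_m = 1 + (2q_m² + 2t∫₀ᵗ p_m²) + (2q_m² + 2t∫₀ᵗ p'_m²)`: measurability and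
  `∫⁻ θ_m^{n} dπ ≤ 5^n (1 + 2·2^n M_q + 2·(2t²)^n M_p)` in terms of the Gibbs moments `M_q = ∫ q_m^{2n}`, `M_p = ∫ p_m^{2n}`
  (`lintegral_siteWeight_pow_le`).
-/

noncomputable section

open MeasureTheory ProbabilityTheory Set Filter Topology Finset
open scoped NNReal ENNReal

namespace Summit.AtomisticToContinuum.FouriersLaw.Cruxes.ConductanceLowerBound.KickDipoleNoCollapse

open Literature.MathematicalPhysics.KineticTheory Literature.MathematicalPhysics.KineticTheory.HeatConduction
open Literature.Probability.Process OscillatorChain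
open Summit.AtomisticToContinuum.FouriersLaw.Theorems
open Summit.AtomisticToContinuum.FouriersLaw.Theorems.NonBallistic

variable {ω₂ lam β γ : ℝ} (hω : 0 < ω₂) (hl : 0 ≤ lam) (hβ : 0 ≤ β) (hγ : 0 ≤ γ) (N : ℕ) {T : ℝ}

/-- **Jensen in time** (local copy for powers of time integrals of a continuous nonnegative integrand):
`(∫₀ᵗ f)^n ≤ t^{n−1} ∫₀ᵗ f^n`, `t ≥ 0`, `n ≥ 1`. -/
theorem pow_intervalIntegral_le' {f : ℝ → ℝ} (hf : Continuous f) (hf0 : ∀ s, 0 ≤ f s) {t : ℝ} (ht : 0 ≤ t) {n : ℕ}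
    (hn : 1 ≤ n) : (∫ s in (0:ℝ)..t, f s) ^ n ≤ t ^ (n - 1) * ∫ s in (0:ℝ)..t, f s ^ n := by
  rcases ht.eq_or_lt with rfl | htpos
  · simp [zero_pow (by omega : n ≠ 0)]
  have hconv : ConvexOn ℝ (Set.Ici (0:ℝ)) (fun x : ℝ => x ^ n) := convexOn_pow n
  have hvol : (volume : Measure ℝ) (Set.Ioc 0 t) ≠ 0 := by
    rw [Real.volume_Ioc]; simp [htpos]
  have hvol' : (volume : Measure ℝ) (Set.Ioc 0 t) ≠ ⊤ := by rw [Real.volume_Ioc]; simp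
  have hJ := hconv.map_set_average_le (continuousOn_pow n) isClosed_Ici hvol hvol'
    (ae_of_all _ fun s => hf0 s) (hf.integrableOn_Ioc) ((hf.pow n).integrableOn_Ioc)
  rw [MeasureTheory.setAverage_eq, MeasureTheory.setAverage_eq] at hJ
  simp only [smul_eq_mul, Measure.real, Real.volume_Ioc, sub_zero, ENNReal.toReal_ofReal ht] at hJ
  rw [intervalIntegral.integral_of_le ht, intervalIntegral.integral_of_le ht]
  rw [mul_pow, inv_pow] at hJ
  have htn : 0 < t ^ n := pow_pos htpos n
  have key : (∫ x in Set.Ioc 0 t, f x) ^ n ≤ t ^ n * (t⁻¹ * ∫ x in Set.Ioc 0 t, f x ^ n) := by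
    rw [← inv_mul_le_iff₀ htn]; exact hJ
  calc (∫ x in Set.Ioc 0 t, f x) ^ n ≤ t ^ n * (t⁻¹ * ∫ x in Set.Ioc 0 t, f x ^ n) := key
    _ = t ^ (n - 1) * ∫ x in Set.Ioc 0 t, f x ^ n := by
        obtain ⟨m, rfl⟩ : ∃ m, n = m + 1 := ⟨n - 1, by omega⟩
        rw [Nat.add_sub_cancel, pow_succ]
        field_simp

include hω hl hβ hγ in
/-- **Stationarity from the flipped start**: for measurable `g ≥ 0`, every site `i₀` and every real time `r`,
`∫⁻ g(Φ_r(x^{i₀}, Bω)) d(μ_T ⊗ W) = ∫⁻ g dμ_T`. -/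
theorem lintegral_prod_solMap_flip_gibbs (hN : 0 < N) (hT : 0 < T) (i₀ : Fin N) (r : ℝ) {g : PhaseSpace N → ℝ≥0∞}
    (hg : Measurable g) :
    ∫⁻ q, g ((pinnedChain ω₂ lam β γ).solMap N T T r (momentumFlip i₀ q.1) (pairPath q.2))
        ∂(((pinnedChain ω₂ lam β γ).gibbsMeasure N T).prod wienerPair) =
      ∫⁻ y, g y ∂((pinnedChain ω₂ lam β γ).gibbsMeasure N T) := by
  set P := pinnedChain ω₂ lam β γ with hP
  set μ := P.gibbsMeasure N T with hμ
  set π : Measure (PhaseSpace N × WienerPair) := μ.prod wienerPair with hπ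
  have hzm : Measurable fun q : PhaseSpace N × WienerPair => P.solMap N T T r q.1 (pairPath q.2) :=
    pinnedChain_measurable_solMap_pairPath hω hl hβ hγ N T T r
  have hΘm : Measurable fun q : PhaseSpace N × WienerPair => (momentumFlip i₀ q.1, q.2) :=
    ((measurable_momentumFlip i₀).comp measurable_fst).prodMk measurable_snd
  have hz'm : Measurable fun q : PhaseSpace N × WienerPair => P.solMap N T T r (momentumFlip i₀ q.1) (pairPath q.2) := by
    have h := hzm.comp hΘm
    exact h
  have hGm : Measurable fun q : PhaseSpace N × WienerPair => g (P.solMap N T T r (momentumFlip i₀ q.1) (pairPath q.2)) := by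
    have h := hg.comp hz'm
    exact h
  have hG0m : Measurable fun q : PhaseSpace N × WienerPair => g (P.solMap N T T r q.1 (pairPath q.2)) := by
    have h := hg.comp hzm
    exact h
  have hiter : ∀ {G : PhaseSpace N × WienerPair → ℝ≥0∞}, Measurable G →
      ∫⁻ x, ∫⁻ ω, G (x, ω) ∂wienerPair ∂μ = ∫⁻ q, G q ∂π := by
    intro G hG
    exact (lintegral_prod G hG.aemeasurable).symm
  have hinner : Measurable fun y : PhaseSpace N => ∫⁻ ω, g (P.solMap N T T r y (pairPath ω)) ∂wienerPair := by
    have h := hG0m.lintegral_prod_right' (ν := wienerPair)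
    exact h
  rw [← hiter (G := fun q => g (P.solMap N T T r (momentumFlip i₀ q.1) (pairPath q.2))) hGm,
    FSAssembly.lintegral_comp_momentumFlip_gibbs P N T i₀ hinner,
    hiter (G := fun q => g (P.solMap N T T r q.1 (pairPath q.2))) hG0m]
  exact pinnedChain_lintegral_prod_solMap_gibbs hω hl hβ hγ N hN hT r hg

include hω hl hβ hγ in
/-- **Moments of the time-integrated squared momentum along the flow**, from either start: for `t ≥ 0`, `n ≥ 1` and the
start map `σ ∈ {id, momentumFlip i₀}` (encoded by a measurable, `μ_T`-preserving `σ` through the stationarity hypothesis),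
`∫⁻ (∫₀ᵗ p_m(Φ_r(σx, Bω))² dr)^n dπ ≤ t^n ∫⁻ p_m^{2n} dμ_T`. -/
theorem lintegral_timeIntegral_momentum_sq_pow_le (hT : 0 < T) {σ : PhaseSpace N → PhaseSpace N} (hσ : Measurable σ)
    (hstat : ∀ (r : ℝ) {g : PhaseSpace N → ℝ≥0∞}, Measurable g →
      ∫⁻ q, g ((pinnedChain ω₂ lam β γ).solMap N T T r (σ q.1) (pairPath q.2))
        ∂(((pinnedChain ω₂ lam β γ).gibbsMeasure N T).prod wienerPair) = ∫⁻ y, g y ∂((pinnedChain ω₂ lam β γ).gibbsMeasure N T))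
    {t : ℝ} (ht : 0 ≤ t) (m : Fin N) {n : ℕ} (hn : 1 ≤ n) :
    ∫⁻ q, ENNReal.ofReal ((∫ r in (0:ℝ)..t, ((pinnedChain ω₂ lam β γ).solMap N T T r (σ q.1) (pairPath q.2)).2 m ^ 2) ^ n)
        ∂(((pinnedChain ω₂ lam β γ).gibbsMeasure N T).prod wienerPair) ≤
      ENNReal.ofReal (t ^ n) * ∫⁻ y, ENNReal.ofReal (y.2 m ^ (2 * n)) ∂((pinnedChain ω₂ lam β γ).gibbsMeasure N T) := by
  set P := pinnedChain ω₂ lam β γ with hP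
  set π := (P.gibbsMeasure N T).prod wienerPair with hπ
  haveI : IsProbabilityMeasure (P.gibbsMeasure N T) := pinnedChain_isProbabilityMeasure_gibbsMeasure hω hl hβ γ N hT
  haveI : SFinite π := by rw [hπ]; infer_instance
  set p : ℝ → PhaseSpace N × WienerPair → ℝ := fun r q => (P.solMap N T T r (σ q.1) (pairPath q.2)).2 m with hp
  have hpc : ∀ q, Continuous fun r => p r q := fun q =>
    (continuous_apply m).comp (continuous_snd.comp (pinnedChain_continuous_solMap hω hl hβ hγ N T T (σ q.1) (pairPath q.2)))
  have hpm : ∀ k : ℕ, Measurable fun qr : (PhaseSpace N × WienerPair) × ℝ => ENNReal.ofReal (p qr.2 qr.1 ^ k) := by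
    intro k
    have h1 := pinnedChain_measurable_solMap_pairPath_uncurry_swap hω hl hβ hγ N T T
    have h2 : Measurable fun qr : (PhaseSpace N × WienerPair) × ℝ => ((σ qr.1.1, qr.1.2), qr.2) :=
      ((hσ.comp (measurable_fst.comp measurable_fst)).prodMk (measurable_snd.comp measurable_fst)).prodMk measurable_snd
    exact (((measurable_pi_apply m).comp (measurable_snd.comp (h1.comp h2))).pow_const k).ennreal_ofReal
  -- pathwise Jensen
  have hJ : ∀ q, (∫ r in (0:ℝ)..t, p r q ^ 2) ^ n ≤ t ^ (n - 1) * ∫ r in (0:ℝ)..t, p r q ^ (2 * n) := by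
    intro q
    have h := pow_intervalIntegral_le' (f := fun r => p r q ^ 2) ((hpc q).pow 2) (fun r => sq_nonneg _) ht hn
    simp only [← pow_mul] at h
    exact h
  have hofReal : ∀ q, ENNReal.ofReal (∫ r in (0:ℝ)..t, p r q ^ (2 * n)) = ∫⁻ r in Ioc 0 t, ENNReal.ofReal (p r q ^ (2 * n)) := by
    intro q
    rw [intervalIntegral.integral_of_le ht]
    exact ofReal_integral_eq_lintegral_ofReal ((hpc q).pow (2 * n)).integrableOn_Ioc
      (ae_of_all _ fun r => show (0:ℝ) ≤ p r q ^ (2 * n) by rw [pow_mul]; positivity)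
  calc ∫⁻ q, ENNReal.ofReal ((∫ r in (0:ℝ)..t, p r q ^ 2) ^ n) ∂π
      ≤ ∫⁻ q, (ENNReal.ofReal (t ^ (n - 1)) * ∫⁻ r in Ioc 0 t, ENNReal.ofReal (p r q ^ (2 * n))) ∂π := by
        refine lintegral_mono fun q => ?_
        rw [← hofReal, ← ENNReal.ofReal_mul (by positivity)]
        exact ENNReal.ofReal_le_ofReal (hJ q)
    _ = ENNReal.ofReal (t ^ (n - 1)) * ∫⁻ r in Ioc 0 t, ∫⁻ q, ENNReal.ofReal (p r q ^ (2 * n)) ∂π := by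
        rw [lintegral_const_mul _ ((hpm (2 * n)).lintegral_prod_right'), lintegral_lintegral_swap (hpm (2 * n)).aemeasurable]
    _ = ENNReal.ofReal (t ^ (n - 1)) * ∫⁻ _r in Ioc 0 t, ∫⁻ y, ENNReal.ofReal (y.2 m ^ (2 * n)) ∂(P.gibbsMeasure N T) := by
        congr 1
        refine lintegral_congr fun r => ?_
        exact hstat r (g := fun y : PhaseSpace N => ENNReal.ofReal (y.2 m ^ (2 * n))) (by fun_prop)
    _ = ENNReal.ofReal (t ^ n) * ∫⁻ y, ENNReal.ofReal (y.2 m ^ (2 * n)) ∂(P.gibbsMeasure N T) := by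
        rw [setLIntegral_const, Real.volume_Ioc, sub_zero, ← mul_assoc, mul_right_comm, ← ENNReal.ofReal_mul (by positivity)]
        congr 2
        obtain ⟨k, rfl⟩ : ∃ k, n = k + 1 := ⟨n - 1, by omega⟩
        rw [Nat.add_sub_cancel, pow_succ]

/-- `(max x y)^n ≤ x^n + y^n` for nonnegative reals. -/
theorem max_pow_le_add {x y : ℝ} (hx : 0 ≤ x) (hy : 0 ≤ y) (n : ℕ) : (max x y) ^ n ≤ x ^ n + y ^ n := by
  rcases le_total x y with h | h
  · rw [max_eq_right h]; linarith [pow_nonneg hx n]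
  · rw [max_eq_left h]; linarith [pow_nonneg hy n]

/-- Power mean for five nonnegative reals: `(a+b+c+d+e)^n ≤ 5^n (a^n + b^n + c^n + d^n + e^n)`
(`sum ≤ 5·max`, `max^n ≤ Σ (·)^n`). -/
theorem add_five_pow_le {a b c d e : ℝ} (ha : 0 ≤ a) (hb : 0 ≤ b) (hc : 0 ≤ c) (hd : 0 ≤ d) (he : 0 ≤ e) (n : ℕ) :
    (a + b + c + d + e) ^ n ≤ 5 ^ n * (a ^ n + b ^ n + c ^ n + d ^ n + e ^ n) := by
  set M := max (max (max (max a b) c) d) e with hM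
  have hM0 : 0 ≤ M := le_trans ha (by simp [hM])
  have hsum : a + b + c + d + e ≤ 5 * M := by
    have h1 : a ≤ M := by simp [hM]
    have h2 : b ≤ M := by simp [hM]
    have h3 : c ≤ M := by simp [hM]
    have h4 : d ≤ M := by simp [hM]
    have h5 : e ≤ M := by simp [hM]
    linarith
  have hMn : M ^ n ≤ a ^ n + b ^ n + c ^ n + d ^ n + e ^ n := by
    have hab : 0 ≤ max a b := le_trans ha (le_max_left _ _)
    have habc : 0 ≤ max (max a b) c := le_trans hab (le_max_left _ _)
    have habcd : 0 ≤ max (max (max a b) c) d := le_trans habc (le_max_left _ _)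
    calc M ^ n ≤ (max (max (max a b) c) d) ^ n + e ^ n := max_pow_le_add habcd he n
      _ ≤ ((max (max a b) c) ^ n + d ^ n) + e ^ n := by linarith [max_pow_le_add habc hd n]
      _ ≤ ((max a b) ^ n + c ^ n + d ^ n) + e ^ n := by linarith [max_pow_le_add hab hc n]
      _ ≤ (a ^ n + b ^ n + c ^ n + d ^ n) + e ^ n := by linarith [max_pow_le_add ha hb n]
      _ = _ := by ring
  calc (a + b + c + d + e) ^ n ≤ (5 * M) ^ n := pow_le_pow_left₀ (by positivity) hsum n
    _ = 5 ^ n * M ^ n := mul_pow _ _ _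
    _ ≤ 5 ^ n * (a ^ n + b ^ n + c ^ n + d ^ n + e ^ n) := mul_le_mul_of_nonneg_left hMn (by positivity)

include hω hl hβ hγ in
/-- **Moments of the light-cone site weight.**  With `I_m = ∫₀ᵗ p_m(Φ_r(x,Bω))² dr`, `I'_m` the same from the flipped start
`x^{i₀}`, and `θ_m = 1 + (2q_m² + 2t I_m) + (2q_m² + 2t I'_m)` (positions are not flipped): for `t ≥ 0`, `n ≥ 1`,
`∫⁻ θ_m^n dπ ≤ 5^n (1 + 2·2^n ∫ q_m^{2n} dμ_T + 2 (2t²)^n ∫ p_m^{2n} dμ_T)` (power mean, stationarity from both starts). -/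
theorem lintegral_siteWeight_pow_le (hN : 0 < N) (hT : 0 < T) (i₀ m : Fin N) {t : ℝ} (ht : 0 ≤ t) {n : ℕ} (hn : 1 ≤ n)
    {Mq Mp : ℝ} (hMq : Integrable (fun y : PhaseSpace N => y.1 m ^ (2 * n)) ((pinnedChain ω₂ lam β γ).gibbsMeasure N T) ∧
      ∫ y, y.1 m ^ (2 * n) ∂((pinnedChain ω₂ lam β γ).gibbsMeasure N T) ≤ Mq)
    (hMp : Integrable (fun y : PhaseSpace N => y.2 m ^ (2 * n)) ((pinnedChain ω₂ lam β γ).gibbsMeasure N T) ∧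
      ∫ y, y.2 m ^ (2 * n) ∂((pinnedChain ω₂ lam β γ).gibbsMeasure N T) ≤ Mp) :
    ∫⁻ q, ENNReal.ofReal ((1 + (2 * q.1.1 m ^ 2 + 2 * t * ∫ r in (0:ℝ)..t,
        ((pinnedChain ω₂ lam β γ).solMap N T T r q.1 (pairPath q.2)).2 m ^ 2) +
        (2 * q.1.1 m ^ 2 + 2 * t * ∫ r in (0:ℝ)..t,
          ((pinnedChain ω₂ lam β γ).solMap N T T r (momentumFlip i₀ q.1) (pairPath q.2)).2 m ^ 2)) ^ n)
        ∂(((pinnedChain ω₂ lam β γ).gibbsMeasure N T).prod wienerPair) ≤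
      ENNReal.ofReal (5 ^ n * (1 + 2 * 2 ^ n * Mq + 2 * (2 * t ^ 2) ^ n * Mp)) := by
  set P := pinnedChain ω₂ lam β γ with hP
  set μ := P.gibbsMeasure N T with hμ
  haveI hμP : IsProbabilityMeasure μ := pinnedChain_isProbabilityMeasure_gibbsMeasure hω hl hβ γ N hT
  set π : Measure (PhaseSpace N × WienerPair) := μ.prod wienerPair with hπ
  haveI : IsProbabilityMeasure π := by rw [hπ]; infer_instance
  -- the pieces
  set I : PhaseSpace N × WienerPair → ℝ := fun q => ∫ r in (0:ℝ)..t, (P.solMap N T T r q.1 (pairPath q.2)).2 m ^ 2 with hI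
  set I' : PhaseSpace N × WienerPair → ℝ := fun q => ∫ r in (0:ℝ)..t, (P.solMap N T T r (momentumFlip i₀ q.1) (pairPath q.2)).2 m ^ 2
    with hI'
  have hI0 : ∀ q, 0 ≤ I q := fun q => intervalIntegral.integral_nonneg ht fun r _ => sq_nonneg _
  have hI'0 : ∀ q, 0 ≤ I' q := fun q => intervalIntegral.integral_nonneg ht fun r _ => sq_nonneg _
  have hIm : Measurable I := pinnedChain_measurable_timeIntegral_momentum_pow hω hl hβ hγ N T T t m 2
  have hΘm : Measurable fun q : PhaseSpace N × WienerPair => (momentumFlip i₀ q.1, q.2) :=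
    ((measurable_momentumFlip i₀).comp measurable_fst).prodMk measurable_snd
  have hI'm : Measurable I' := by
    have h := hIm.comp hΘm
    exact h
  have hqm : Measurable fun q : PhaseSpace N × WienerPair => q.1.1 m :=
    (measurable_pi_apply m).comp (measurable_fst.comp measurable_fst)
  -- moments of the pieces
  have hev : ∀ r : ℝ, 0 ≤ r ^ (2 * n) := fun r => by rw [pow_mul]; positivity
  have hMq0 : 0 ≤ Mq := le_trans (integral_nonneg fun y => hev _) hMq.2
  have hMp0 : 0 ≤ Mp := le_trans (integral_nonneg fun y => hev _) hMp.2
  have hA : ∫⁻ q, ENNReal.ofReal ((2 * q.1.1 m ^ 2) ^ n) ∂π = ENNReal.ofReal (2 ^ n * ∫ y, y.1 m ^ (2 * n) ∂μ) := by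
    have e : ∀ q : PhaseSpace N × WienerPair, ENNReal.ofReal ((2 * q.1.1 m ^ 2) ^ n) = ENNReal.ofReal (2 ^ n * q.1.1 m ^ (2 * n)) := by
      intro q; rw [mul_pow, pow_mul]
    simp_rw [e]
    have hm2 : Measurable fun q : PhaseSpace N × WienerPair => ENNReal.ofReal (2 ^ n * q.1.1 m ^ (2 * n)) := by fun_prop
    rw [lintegral_prod _ hm2.aemeasurable]
    have e2 : ∀ x : PhaseSpace N, ∫⁻ _ω, ENNReal.ofReal (2 ^ n * x.1 m ^ (2 * n)) ∂wienerPair = ENNReal.ofReal (2 ^ n * x.1 m ^ (2 * n)) := by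
      intro x; rw [lintegral_const, measure_univ, mul_one]
    rw [lintegral_congr e2, ← integral_const_mul,
      ofReal_integral_eq_lintegral_ofReal (hMq.1.const_mul _) (ae_of_all _ fun y => mul_nonneg (by positivity) (hev _))]
  have hB : ∫⁻ q, ENNReal.ofReal ((2 * t * I q) ^ n) ∂π ≤ ENNReal.ofReal ((2 * t ^ 2) ^ n * Mp) := by
    have e : ∀ q, ENNReal.ofReal ((2 * t * I q) ^ n) = ENNReal.ofReal ((2 * t) ^ n) * ENNReal.ofReal (I q ^ n) := by
      intro q; rw [mul_pow, ENNReal.ofReal_mul (by positivity)]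
    simp_rw [e]
    rw [lintegral_const_mul _ (hIm.pow_const n).ennreal_ofReal]
    have h := lintegral_timeIntegral_momentum_sq_pow_le hω hl hβ hγ N hT measurable_id
      (fun r g hg => pinnedChain_lintegral_prod_solMap_gibbs hω hl hβ hγ N hN hT r hg) ht m hn
    have hval : ∫⁻ y, ENNReal.ofReal (y.2 m ^ (2 * n)) ∂μ ≤ ENNReal.ofReal Mp := by
      rw [← ofReal_integral_eq_lintegral_ofReal hMp.1 (ae_of_all _ fun y => hev _)]
      exact ENNReal.ofReal_le_ofReal hMp.2
    calc ENNReal.ofReal ((2 * t) ^ n) * ∫⁻ q, ENNReal.ofReal (I q ^ n) ∂π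
        ≤ ENNReal.ofReal ((2 * t) ^ n) * (ENNReal.ofReal (t ^ n) * ENNReal.ofReal Mp) :=
          mul_le_mul' le_rfl (h.trans (mul_le_mul' le_rfl hval))
      _ = ENNReal.ofReal ((2 * t ^ 2) ^ n * Mp) := by
          rw [← ENNReal.ofReal_mul (by positivity), ← ENNReal.ofReal_mul (by positivity)]
          congr 1; rw [mul_pow, mul_pow]; ring
  have hB' : ∫⁻ q, ENNReal.ofReal ((2 * t * I' q) ^ n) ∂π ≤ ENNReal.ofReal ((2 * t ^ 2) ^ n * Mp) := by
    have e : ∀ q, ENNReal.ofReal ((2 * t * I' q) ^ n) = ENNReal.ofReal ((2 * t) ^ n) * ENNReal.ofReal (I' q ^ n) := by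
      intro q; rw [mul_pow, ENNReal.ofReal_mul (by positivity)]
    simp_rw [e]
    rw [lintegral_const_mul _ (hI'm.pow_const n).ennreal_ofReal]
    have h := lintegral_timeIntegral_momentum_sq_pow_le hω hl hβ hγ N hT (measurable_momentumFlip i₀)
      (fun r g hg => lintegral_prod_solMap_flip_gibbs hω hl hβ hγ N hN hT i₀ r hg) ht m hn
    have hval : ∫⁻ y, ENNReal.ofReal (y.2 m ^ (2 * n)) ∂μ ≤ ENNReal.ofReal Mp := by
      rw [← ofReal_integral_eq_lintegral_ofReal hMp.1 (ae_of_all _ fun y => hev _)]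
      exact ENNReal.ofReal_le_ofReal hMp.2
    calc ENNReal.ofReal ((2 * t) ^ n) * ∫⁻ q, ENNReal.ofReal (I' q ^ n) ∂π
        ≤ ENNReal.ofReal ((2 * t) ^ n) * (ENNReal.ofReal (t ^ n) * ENNReal.ofReal Mp) :=
          mul_le_mul' le_rfl (h.trans (mul_le_mul' le_rfl hval))
      _ = ENNReal.ofReal ((2 * t ^ 2) ^ n * Mp) := by
          rw [← ENNReal.ofReal_mul (by positivity), ← ENNReal.ofReal_mul (by positivity)]
          congr 1; rw [mul_pow, mul_pow]; ring
  -- pointwise power mean and linearity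
  have hpt : ∀ q, ENNReal.ofReal ((1 + (2 * q.1.1 m ^ 2 + 2 * t * I q) + (2 * q.1.1 m ^ 2 + 2 * t * I' q)) ^ n) ≤
      ENNReal.ofReal (5 ^ n) * (1 + ENNReal.ofReal ((2 * q.1.1 m ^ 2) ^ n) + ENNReal.ofReal ((2 * t * I q) ^ n) +
        ENNReal.ofReal ((2 * q.1.1 m ^ 2) ^ n) + ENNReal.ofReal ((2 * t * I' q) ^ n)) := by
    intro q
    have hq0 : 0 ≤ 2 * q.1.1 m ^ 2 := by positivity
    have hc0 : 0 ≤ 2 * t * I q := by have := hI0 q; positivity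
    have he0 : 0 ≤ 2 * t * I' q := by have := hI'0 q; positivity
    have h := add_five_pow_le (a := 1) (b := 2 * q.1.1 m ^ 2) (c := 2 * t * I q) (d := 2 * q.1.1 m ^ 2) (e := 2 * t * I' q)
      zero_le_one hq0 hc0 hq0 he0 n
    rw [one_pow] at h
    calc ENNReal.ofReal ((1 + (2 * q.1.1 m ^ 2 + 2 * t * I q) + (2 * q.1.1 m ^ 2 + 2 * t * I' q)) ^ n)
        ≤ ENNReal.ofReal (5 ^ n * (1 + (2 * q.1.1 m ^ 2) ^ n + (2 * t * I q) ^ n + (2 * q.1.1 m ^ 2) ^ n + (2 * t * I' q) ^ n)) := by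
          refine ENNReal.ofReal_le_ofReal ?_
          have e : 1 + (2 * q.1.1 m ^ 2 + 2 * t * I q) + (2 * q.1.1 m ^ 2 + 2 * t * I' q) =
            1 + 2 * q.1.1 m ^ 2 + 2 * t * I q + 2 * q.1.1 m ^ 2 + 2 * t * I' q := by ring
          rw [e]; exact h
      _ = _ := by
          have h1 : 0 ≤ (2 * t * I q) ^ n := by have := hI0 q; positivity
          have h2 : 0 ≤ (2 * t * I' q) ^ n := by have := hI'0 q; positivity
          rw [ENNReal.ofReal_mul (by positivity), ENNReal.ofReal_add (by positivity) h2,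
            ENNReal.ofReal_add (by positivity) (by positivity), ENNReal.ofReal_add (by positivity) h1,
            ENNReal.ofReal_add zero_le_one (by positivity), ENNReal.ofReal_one]
  have hm1 : Measurable fun q : PhaseSpace N × WienerPair => ENNReal.ofReal ((2 * q.1.1 m ^ 2) ^ n) := by fun_prop
  have hm2 : Measurable fun q : PhaseSpace N × WienerPair => ENNReal.ofReal ((2 * t * I q) ^ n) :=
    ((hIm.const_mul _).pow_const n).ennreal_ofReal
  have hm3 : Measurable fun q : PhaseSpace N × WienerPair => ENNReal.ofReal ((2 * t * I' q) ^ n) :=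
    ((hI'm.const_mul _).pow_const n).ennreal_ofReal
  calc ∫⁻ q, ENNReal.ofReal ((1 + (2 * q.1.1 m ^ 2 + 2 * t * I q) + (2 * q.1.1 m ^ 2 + 2 * t * I' q)) ^ n) ∂π
      ≤ ∫⁻ q, ENNReal.ofReal (5 ^ n) * (1 + ENNReal.ofReal ((2 * q.1.1 m ^ 2) ^ n) + ENNReal.ofReal ((2 * t * I q) ^ n) +
        ENNReal.ofReal ((2 * q.1.1 m ^ 2) ^ n) + ENNReal.ofReal ((2 * t * I' q) ^ n)) ∂π := lintegral_mono hpt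
    _ = ENNReal.ofReal (5 ^ n) * (1 + ∫⁻ q, ENNReal.ofReal ((2 * q.1.1 m ^ 2) ^ n) ∂π + ∫⁻ q, ENNReal.ofReal ((2 * t * I q) ^ n) ∂π +
        ∫⁻ q, ENNReal.ofReal ((2 * q.1.1 m ^ 2) ^ n) ∂π + ∫⁻ q, ENNReal.ofReal ((2 * t * I' q) ^ n) ∂π) := by
        have hsm : Measurable fun q : PhaseSpace N × WienerPair => (1 : ℝ≥0∞) + ENNReal.ofReal ((2 * q.1.1 m ^ 2) ^ n) +
            ENNReal.ofReal ((2 * t * I q) ^ n) + ENNReal.ofReal ((2 * q.1.1 m ^ 2) ^ n) + ENNReal.ofReal ((2 * t * I' q) ^ n) :=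
          (((measurable_const.add hm1).add hm2).add hm1).add hm3
        rw [lintegral_const_mul _ hsm,
          lintegral_add_right _ hm3, lintegral_add_right _ hm1, lintegral_add_right _ hm2, lintegral_add_right _ hm1,
          lintegral_const, measure_univ, mul_one]
    _ ≤ ENNReal.ofReal (5 ^ n) * (1 + ENNReal.ofReal (2 ^ n * Mq) + ENNReal.ofReal ((2 * t ^ 2) ^ n * Mp) +
        ENNReal.ofReal (2 ^ n * Mq) + ENNReal.ofReal ((2 * t ^ 2) ^ n * Mp)) := by
        have hA' : ∫⁻ q, ENNReal.ofReal ((2 * q.1.1 m ^ 2) ^ n) ∂π ≤ ENNReal.ofReal (2 ^ n * Mq) := by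
          rw [hA]; exact ENNReal.ofReal_le_ofReal (mul_le_mul_of_nonneg_left hMq.2 (by positivity))
        gcongr
    _ = ENNReal.ofReal (5 ^ n * (1 + 2 * 2 ^ n * Mq + 2 * (2 * t ^ 2) ^ n * Mp)) := by
        rw [← ENNReal.ofReal_one, ← ENNReal.ofReal_add (by positivity) (by positivity),
          ← ENNReal.ofReal_add (by positivity) (by positivity), ← ENNReal.ofReal_add (by positivity) (by positivity),
          ← ENNReal.ofReal_add (by positivity) (by positivity), ← ENNReal.ofReal_mul (by positivity)]
        congr 1; ring

/-- **Registered helper `helper_kdSiteWeightMoments` (stub S, line `kick-dipole-no-collapse`): MOMENTS OF THE LIGHT-CONE SITE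
WEIGHTS UNDER GIBBS ⊗ WIENER** (closed form of `lintegral_siteWeight_pow_le`).  For the pinned chain (`ω₂ > 0`, `lam, β, γ ≥ 0`),
`N ≥ 1`, `T > 0`, sites `i₀, m`, `t ≥ 0`, `n ≥ 1` and Gibbs moment bounds `∫ q_m^{2n} dμ_T ≤ Mq`, `∫ p_m^{2n} dμ_T ≤ Mp`:
`∫⁻ θ_m^n d(μ_T ⊗ W) ≤ 5^n (1 + 2·2^n Mq + 2(2t²)^n Mp)` for the site weight
`θ_m = 1 + (2q_m² + 2t∫₀ᵗ p_m(Φ_r(x))²) + (2q_m² + 2t∫₀ᵗ p_m(Φ_r(x^{i₀}))²)`. -/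
theorem helper_kdSiteWeightMoments : ∀ ω₂ lam β γ : ℝ, 0 < ω₂ → 0 ≤ lam → 0 ≤ β → 0 ≤ γ → ∀ (N : ℕ), 0 < N → ∀ (T : ℝ), 0 < T → ∀ (i₀ m : Fin N) (t : ℝ), 0 ≤ t → ∀ (n : ℕ), 1 ≤ n → ∀ (Mq Mp : ℝ), (Integrable (fun y : PhaseSpace N => y.1 m ^ (2 * n)) ((pinnedChain ω₂ lam β γ).gibbsMeasure N T) ∧ ∫ y, y.1 m ^ (2 * n) ∂((pinnedChain ω₂ lam β γ).gibbsMeasure N T) ≤ Mq) → (Integrable (fun y : PhaseSpace N => y.2 m ^ (2 * n)) ((pinnedChain ω₂ lam β γ).gibbsMeasure N T) ∧ ∫ y, y.2 m ^ (2 * n) ∂((pinnedChain ω₂ lam β γ).gibbsMeasure N T) ≤ Mp) → ∫⁻ q, ENNReal.ofReal ((1 + (2 * q.1.1 m ^ 2 + 2 * t * ∫ r in (0:ℝ)..t, ((pinnedChain ω₂ lam β γ).solMap N T T r q.1 (pairPath q.2)).2 m ^ 2) + (2 * q.1.1 m ^ 2 + 2 * t * ∫ r in (0:ℝ)..t, ((pinnedChain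 ω₂ lam β γ).solMap N T T r (momentumFlip i₀ q.1) (pairPath q.2)).2 m ^ 2)) ^ n) ∂(((pinnedChain ω₂ lam β γ).gibbsMeasure N T).prod wienerPair) ≤ ENNReal.ofReal (5 ^ n * (1 + 2 * 2 ^ n * Mq + 2 * (2 * t ^ 2) ^ n * Mp)) := by
  intro ω₂ lam β γ hω hl hβ hγ N hN T hT i₀ m t ht n hn Mq Mp hMq hMp
  exact lintegral_siteWeight_pow_le hω hl hβ hγ N hN hT i₀ m ht hn hMq hMp

end Summit.AtomisticToContinuum.FouriersLaw.Cruxes.ConductanceLowerBound.KickDipoleNoCollapse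

end
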